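import Literature.AlgebraicGeometry.Motives.MumfordTateGroupOfOrientationWeightThree
import Literature.AlgebraicGeometry.Motives.HodgeStructureOrientationOfGaloisDegree
import HarnessLib

/-!
# GGK's Question (V.A.10) at the level of Mumford–Tate groups: `MT(V³_{(L,Π)})(ℂ) < MT(J_G(V))(ℂ)` for the `(ℤ/2)³` example —
# the Mumford–Tate group of a CY-type weight-three SCMpHS can be a PROPER subgroup of that of its G-Jacobian

[topic AlgebraicGeometry/Motives]

Layer `Literature/AlgebraicGeometry/Motives`, lane `lit-hodgefound` (Track 2 foundations library; seat `lit-hodgefound-p02`, gen 27,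
row g27-#9).  THEOREMS ONLY (no definition, no named fact; net debt `0`).  Joins g27-#6
`Motives/MumfordTateGroupOfOrientationMonotone` (`MT(V_{Λ′})(ℂ) ≤ MT(V_Λ)(ℂ) ⟺ W_{Λ′} ≤ W_Λ` over `Aut(ℂ)`), g27-#8
`Motives/MumfordTateGroupOfOrientationWeightThree` (`MT(V³_Π) ≤ MT(J_G) ⊔ MT(J_W)` and the surjections) and p02's g26-#7
`Motives/HodgeStructureOrientationOfGaloisDegree` (the oriented Galois CM field `(L,Π)` with `Gal(L/ℚ) ≅ (ℤ/2)³` and its G-type `Θ`,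
`𝓡(L,Π) = 4 < 5 = 𝓡(L,Θ)` — Question (V.A.10) answered in the negative for ranks).

THE PRINTS.  GGK [GreenGriffithsKerr2012] (V.A.10) p. 158: «**Question:** If `Θ ∈ Θ(Π)` as in (V.A.2), is `𝓡(F,Π) ≥ 𝓡(F,Θ)`?»;
(V.D.4) p. 164 «`Im(𝒩_{Π′}) = M_φ̃`», (V.D.5) «`dim M_φ̃ = 𝓡(F,Π)`»; §V.D p. 165 after (V.D.7) «the Mumford–Tate group of the tensor
product … surjects onto each factor as well as onto `M_{φ^n_{(F,Π)}}`»; (V.A.7) p. 157 (`𝓡` on `𝒢 = Gal(F^c/ℚ)`).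

WHAT IS PROVED.
* §1 (any number field `K`, `L ⊇ j(K)` normal, `ι : L → ℂ`; `[HodgeTensorFacts.{0,0}]` for the group statements) — (V.D.4) as an order
  statement IN GGK's `𝒢`-LANGUAGE: `degSpan_galoisDeg_eq_map`, **`degSpan_galoisDeg_le_iff`** (`W_{p′} ≤ W_p` on `𝒢` ⟺ `W′ ≤ W` on `Hom(K,ℂ)`
  over `Aut(ℂ)`), **`mumfordTateGroupBaseChange_complex_ofOrientation_le_iff_degSpan_galoisDeg_le`**
  (`MT(V_{Λ′})(ℂ) ≤ MT(V_Λ)(ℂ) ⟺ W_{p_{Λ′}} ≤ W_{p_Λ}`), **`kubotaRank_le_of_mumfordTateGroupBaseChange_complex_ofOrientation_le`**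
  (`⟹ 𝓡(Λ′) ≤ 𝓡(Λ)` — so (V.A.10) holds for every `Θ` whose Jacobian has `MT(J_Θ)(ℂ) ≤ MT(V)(ℂ)`:
  `kubotaRank_ofCMType_le_of_mumfordTateGroupBaseChange_le`), `mtRank_le_of_…`, `not_mumfordTateGroupBaseChange_complex_ofOrientation_le_of_kubotaRank_lt`.
* §2 (group level `G8 = (ℤ/2)³`, namespace `…ComplexMultiplication.CounterexampleVA10`) `degSpan_comp_mulEquiv`, `degSpan_comp_mulEquiv_le_iff`,
  `two_mul_p8_eq_t8` (`2p = 6t + 3t_ρ − t_{001} − t_{010} − t_{011}`, a finite check), **`degSpan_p8_le_degSpan_t8 : W_p ≤ W_t`**, `degSpan_p8_lt_degSpan_t8`.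
* §3 (the oriented Galois CM field `(L, Π)` of g26-#7, `e : Gal(L/ℚ) ≃* G8`, `e(ρ) = ρ8`)
  **`mumfordTateGroupBaseChange_complex_orientationPi_le`** (`MT(V³_{(L,Π)})(ℂ) ≤ MT(V¹_{(L,Θ)})(ℂ)`),
  **`not_mumfordTateGroupBaseChange_complex_orientationTheta_le`** (`MT(V¹_Θ)(ℂ) ≰ MT(V³_Π)(ℂ)`),
  **`mumfordTateGroupBaseChange_complex_orientationPi_lt`** (STRICT inclusion), `mtRank_orientationPi = 4`, `mtRank_orientationTheta = 5`,
  `orientationTheta_eq_ofCMType_gType` (`Θ` is the G-type `Θ^G_Π` of g24-#1), **`mumfordTateGroupBaseChange_complex_orientationPi_lt_gType`**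
  (`MT(V)(ℂ) < MT(J_G(V))(ℂ)`), `mumfordTateGroupBaseChange_complex_wType_le_gType` (`MT(J_W(V))(ℂ) ≤ MT(J_G(V))(ℂ)`, by g27-#8's surjection
  `MT(J_W) ≤ MT(V) ⊔ MT(J_G)`), **`mumfordTateGroupBaseChange_complex_orientationPi_sup_wType_sup_le_gType`** (all three inside `MT(J_G)(ℂ)`).

HONEST SCOPE.  (1) §3 is stated for any `(L, ι, e, he)` as in g26-#7 (e.g. `L = ℚ(ζ₂₄)`, `Motives/CyclotomicFieldTwentyFourOrientation`); the
strictness `MT(V) < MT(J_G)` is a READING NOTE on (V.A.10)/(V.D.7) (GGK ask only about ranks), proved.  (2) Point groups over `ℂ` inside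
`GL(ℂ ⊗ L)`; the Jacobians enter as the weight-one Hodge structures `ofOrientation Θ` / `ofCMType`.

## References
* [GreenGriffithsKerr2012] M. Green, P. Griffiths, M. Kerr, *Mumford–Tate Groups and Domains: Their Geometry and Arithmetic*, Ann. of
  Math. Stud. 183 (2012): (V.A.10) p. 158, (V.A.7) p. 157, (V.D.4)–(V.D.5) p. 164, (V.D.7) p. 165.
* [Deligne1982HodgeCycles] P. Deligne, *Hodge cycles on abelian varieties*, LNM 900 (1982), I Ex. 3.7 (c).
* [Shimura1998] G. Shimura, *Abelian Varieties with Complex Multiplication and Modular Functions* (1998), §32.7.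
-/

noncomputable section

open scoped TensorProduct Classical Pointwise
open Module NumberField

/-! ## §2 (first, no Hodge theory) `W_p ≤ W_t` on `(ℤ/2)³` -/

namespace Literature.NumberTheory.ComplexMultiplication

/-- **Transport of the module of translates along a group isomorphism** `e : G ≃* G′` (left regular actions):
`W_{p′ ∘ e} = e^* W_{p′}` (the span statement behind g26-#7's `degRank_comp_mulEquiv`). [cite: GreenGriffithsKerr2012, (V.A.7) p. 157] -/
theorem degSpan_comp_mulEquiv {G G' : Type*} [Group G] [Group G'] (e : G ≃* G') (p' : G' → ℤ) :
    degSpan G (p' ∘ e) = (degSpan G' p').map (LinearMap.funLeft ℚ ℚ e) := by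
  rw [degSpan, degSpan, Submodule.map_span]
  congr 1
  ext f
  constructor
  · rintro ⟨g, rfl⟩
    refine ⟨degTranslate p' (e g), ⟨e g, rfl⟩, ?_⟩
    funext x
    simp only [LinearMap.funLeft_apply, degTranslate_apply, smul_eq_mul, Function.comp_apply, map_mul]
  · rintro ⟨_, ⟨g', rfl⟩, rfl⟩
    refine ⟨e.symm g', ?_⟩
    funext x
    simp only [LinearMap.funLeft_apply, degTranslate_apply, smul_eq_mul, Function.comp_apply, map_mul,
      MulEquiv.apply_symm_apply]

/-- … so inclusions of modules of translates transport along `e`. [cite: GreenGriffithsKerr2012, (V.A.7) p. 157] -/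
theorem degSpan_comp_mulEquiv_le_iff {G G' : Type*} [Group G] [Group G'] (e : G ≃* G') (p' q' : G' → ℤ) :
    degSpan G (p' ∘ e) ≤ degSpan G (q' ∘ e) ↔ degSpan G' p' ≤ degSpan G' q' := by
  rw [degSpan_comp_mulEquiv, degSpan_comp_mulEquiv,
    Submodule.map_le_map_iff_of_injective (LinearMap.funLeft_injective_of_surjective ℚ ℚ e e.surjective)]

namespace CounterexampleVA10

/-- **`2·p = 6·t + 3·t_ρ − t_{001} − t_{010} − t_{011}` on `(ℤ/2)³`** — the degree function of `Π` is a rational combination of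
translates of the indicator `t` of its G-type `Θ` (a finite check; `t_k(h) = t(kh)`). [cite: GreenGriffithsKerr2012, (V.A.10) p. 158 and (V.A.7) p. 157] -/
theorem two_mul_p8_eq_t8 (h : G8) :
    2 * p8 h = 6 * t8 h + 3 * t8 (ρ8 * h) - t8 (el 0 0 1 * h) - t8 (el 0 1 0 * h) - t8 (el 0 1 1 * h) := by
  revert h
  decide

/-- The translated form: `p_g = ½(6·t_g + 3·t_{ρg} − t_{001·g} − t_{010·g} − t_{011·g})`. [cite: GreenGriffithsKerr2012, (V.A.7) p. 157] -/
theorem degTranslate_p8_eq (g : G8) :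
    degTranslate p8 g = (2 : ℚ)⁻¹ • ((6 : ℚ) • degTranslate t8 g + (3 : ℚ) • degTranslate t8 (ρ8 * g) -
      degTranslate t8 (el 0 0 1 * g) - degTranslate t8 (el 0 1 0 * g) - degTranslate t8 (el 0 1 1 * g)) := by
  funext x
  have e := two_mul_p8_eq_t8 (g * x)
  have e' : (2 : ℚ) * (p8 (g * x) : ℚ) = 6 * (t8 (g * x) : ℚ) + 3 * (t8 (ρ8 * (g * x)) : ℚ) - (t8 (el 0 0 1 * (g * x)) : ℚ) -
      (t8 (el 0 1 0 * (g * x)) : ℚ) - (t8 (el 0 1 1 * (g * x)) : ℚ) := by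
    exact_mod_cast e
  simp only [degTranslate_apply, smul_eq_mul, Pi.smul_apply, Pi.add_apply, Pi.sub_apply, mul_assoc, ← e']
  ring

/-- **`W_p ≤ W_t` on `(ℤ/2)³`**: the module of the `3`-orientation `Π` of (the group-level) g26-#7 lies in the module of its G-type `Θ`.
[cite: GreenGriffithsKerr2012, (V.A.10) p. 158 and (V.A.7) p. 157] -/
theorem degSpan_p8_le_degSpan_t8 : degSpan G8 p8 ≤ degSpan G8 t8 := by
  refine Submodule.span_le.2 ?_
  rintro _ ⟨g, rfl⟩
  change degTranslate p8 g ∈ _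
  rw [degTranslate_p8_eq]
  exact Submodule.smul_mem _ _ (Submodule.sub_mem _ (Submodule.sub_mem _ (Submodule.sub_mem _ (Submodule.add_mem _
    (Submodule.smul_mem _ _ (degTranslate_mem_degSpan t8 _)) (Submodule.smul_mem _ _ (degTranslate_mem_degSpan t8 _)))
    (degTranslate_mem_degSpan t8 _)) (degTranslate_mem_degSpan t8 _)) (degTranslate_mem_degSpan t8 _))

/-- **`W_p < W_t`** (dimensions `4 < 5`: g26-#7's `degRank_p8`, `degRank_t8`). [cite: GreenGriffithsKerr2012, (V.A.10) p. 158] -/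
theorem degSpan_p8_lt_degSpan_t8 : degSpan G8 p8 < degSpan G8 t8 := by
  refine Submodule.lt_of_le_of_finrank_lt_finrank degSpan_p8_le_degSpan_t8 ?_
  rw [← degRank_eq_finrank_degSpan, ← degRank_eq_finrank_degSpan, degRank_p8, degRank_t8]
  norm_num

end CounterexampleVA10

end Literature.NumberTheory.ComplexMultiplication

/-! ## §1 (V.D.4) as an order statement in GGK's `𝒢`-language; rank monotonicity -/

namespace Literature.AlgebraicGeometry.Motives

namespace HodgeStructure

open Literature.NumberTheory.ComplexMultiplication

section Transfer

variable {K : Type} [Field K] [NumberField K] {n n' : ℤ} (Λ : Orientation K n) (Λ' : Orientation K n')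
  {L : Type} [Field L] [NumberField L] [Normal ℚ L] (j : K →ₐ[ℚ] L) (ι : L →+* ℂ)

include j in
/-- `W_{p′} ≤ W_p` on `Hom_ℚ(K,L)` iff `W′ ≤ W` on `Hom(K,ℂ)` over `Aut(ℂ)` (g26-#1's `degSpan_embDeg_eq_map`: the SAME linear isomorphism
carries both). [cite: Shimura1998, §32.7] [cite: GreenGriffithsKerr2012, (V.A.7) p. 157] -/
theorem degSpan_embDeg_le_iff :
    degSpan (L ≃ₐ[ℚ] L) (Λ'.embDeg ι) ≤ degSpan (L ≃ₐ[ℚ] L) (Λ.embDeg ι) ↔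
      degSpan (ℂ ≃+* ℂ) Λ'.deg ≤ degSpan (ℂ ≃+* ℂ) Λ.deg := by
  rw [degSpan_embDeg_eq_map Λ' j ι, degSpan_embDeg_eq_map Λ j ι]
  exact Submodule.map_le_map_iff_of_injective (LinearEquiv.injective _) _ _

omit [Normal ℚ L] in
/-- `W_p` on `𝒢 = Gal(L/ℚ)` is the pullback of `W` on `Hom_ℚ(K,L)` along the orbit map `g ↦ g • j` (p02's `degSpan_comp`).
[cite: GreenGriffithsKerr2012, (V.A.3) p. 156 and (V.A.7) p. 157] -/
theorem degSpan_galoisDeg_eq_map :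
    degSpan (L ≃ₐ[ℚ] L) (Λ.galoisDeg j ι) =
      (degSpan (L ≃ₐ[ℚ] L) (Λ.embDeg ι)).map (LinearMap.funLeft ℚ ℚ fun g : L ≃ₐ[ℚ] L => g • j) := by
  have h : Λ.galoisDeg j ι = Λ.embDeg ι ∘ fun g : L ≃ₐ[ℚ] L => g • j := rfl
  rw [h]
  exact degSpan_comp (G := L ≃ₐ[ℚ] L) (fun g : L ≃ₐ[ℚ] L => g • j) (fun g x => mul_smul g x j) (Λ.embDeg ι)

/-- **`W_{p_{Λ′}} ≤ W_{p_Λ}` on `𝒢` ⟺ `W_{Λ′} ≤ W_Λ` over `Aut(ℂ)`** (`L ⊇ j(K)` normal). [cite: GreenGriffithsKerr2012, (V.A.7) p. 157] [cite: Shimura1998, §32.7] -/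
theorem degSpan_galoisDeg_le_iff :
    degSpan (L ≃ₐ[ℚ] L) (Λ'.galoisDeg j ι) ≤ degSpan (L ≃ₐ[ℚ] L) (Λ.galoisDeg j ι) ↔
      degSpan (ℂ ≃+* ℂ) Λ'.deg ≤ degSpan (ℂ ≃+* ℂ) Λ.deg := by
  rw [degSpan_galoisDeg_eq_map Λ' j ι, degSpan_galoisDeg_eq_map Λ j ι,
    Submodule.map_le_map_iff_of_injective
      (LinearMap.funLeft_injective_of_surjective ℚ ℚ _ (MulAction.surjective_smul (L ≃ₐ[ℚ] L) j)),
    degSpan_embDeg_le_iff Λ Λ' j ι]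

variable [HodgeTensorFacts.{0, 0}]

/-- **(V.D.4) as an order statement in GGK's `𝒢`-language: `MT(V_{Λ′})(ℂ) ≤ MT(V_Λ)(ℂ) ⟺ W_{p_{Λ′}} ≤ W_{p_Λ}`** (`p = galoisDeg` on
`𝒢 = Gal(L/ℚ)`, `L ⊇ j(K)` normal; g27-#6 over `Aut(ℂ)` + the transfer). [cite: GreenGriffithsKerr2012, (V.D.4) p. 164 and (V.A.7) p. 157]
[cite: Deligne1982HodgeCycles, I Example 3.7 (c)] -/
theorem mumfordTateGroupBaseChange_complex_ofOrientation_le_iff_degSpan_galoisDeg_le :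
    (ofOrientation Λ').mumfordTateGroupBaseChange ℂ ≤ (ofOrientation Λ).mumfordTateGroupBaseChange ℂ ↔
      degSpan (L ≃ₐ[ℚ] L) (Λ'.galoisDeg j ι) ≤ degSpan (L ≃ₐ[ℚ] L) (Λ.galoisDeg j ι) := by
  rw [mumfordTateGroupBaseChange_complex_ofOrientation_le_iff_degSpan_le, degSpan_galoisDeg_le_iff Λ Λ' j ι]

include j ι in
/-- **`MT(V_{Λ′})(ℂ) ≤ MT(V_Λ)(ℂ) ⟹ 𝓡(Λ′) ≤ 𝓡(Λ)`** (dimensions of the modules; (V.D.5) `dim M_φ̃ = 𝓡`).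
[cite: GreenGriffithsKerr2012, (V.D.5) p. 164 and (V.A.10) p. 158] -/
theorem kubotaRank_le_of_mumfordTateGroupBaseChange_complex_ofOrientation_le
    (h : (ofOrientation Λ').mumfordTateGroupBaseChange ℂ ≤ (ofOrientation Λ).mumfordTateGroupBaseChange ℂ) :
    Λ'.kubotaRank j ι ≤ Λ.kubotaRank j ι := by
  rw [kubotaRank_eq_degRank_aut Λ' j ι, kubotaRank_eq_degRank_aut Λ j ι, degRank_eq_finrank_degSpan, degRank_eq_finrank_degSpan]
  exact Submodule.finrank_mono ((mumfordTateGroupBaseChange_complex_ofOrientation_le_iff_degSpan_le Λ Λ').1 h)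

omit [NumberField L] [Normal ℚ L] in
/-- The same for the dimensions of the Mumford–Tate groups: `MT(V_{Λ′})(ℂ) ≤ MT(V_Λ)(ℂ) ⟹ dim M_φ̃(V_{Λ′}) ≤ dim M_φ̃(V_Λ)` (no auxiliary field).
[cite: GreenGriffithsKerr2012, (V.D.5) p. 164] -/
theorem mtRank_le_of_mumfordTateGroupBaseChange_complex_ofOrientation_le
    (h : (ofOrientation Λ').mumfordTateGroupBaseChange ℂ ≤ (ofOrientation Λ).mumfordTateGroupBaseChange ℂ) :
    (ofOrientation Λ').mtRank ≤ (ofOrientation Λ).mtRank := by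
  rw [mtRank_ofOrientation_eq_degRank, mtRank_ofOrientation_eq_degRank, degRank_eq_finrank_degSpan, degRank_eq_finrank_degSpan]
  exact Submodule.finrank_mono ((mumfordTateGroupBaseChange_complex_ofOrientation_le_iff_degSpan_le Λ Λ').1 h)

include j ι in
/-- **(V.A.10) holds for every type whose Jacobian is controlled by `V`:** `MT(V¹_{(F,Θ)})(ℂ) ≤ MT(V^n_{(F,Π)})(ℂ) ⟹ 𝓡(F,Θ) ≤ 𝓡(F,Π)`
(`𝓡(F,Θ) = 𝓡(F,Π(Θ))`, g25-#1's `kubotaRank_ofCMType`). [cite: GreenGriffithsKerr2012, (V.A.10) p. 158 and (V.D.7) p. 165] -/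
theorem kubotaRank_ofCMType_le_of_mumfordTateGroupBaseChange_le (Θ : CMType K)
    (h : (ofCMType Θ).mumfordTateGroupBaseChange ℂ ≤ (ofOrientation Λ).mumfordTateGroupBaseChange ℂ) :
    (Orientation.ofCMType Θ).kubotaRank j ι ≤ Λ.kubotaRank j ι := by
  rw [← ofOrientation_ofCMType] at h
  exact kubotaRank_le_of_mumfordTateGroupBaseChange_complex_ofOrientation_le Λ _ j ι h

include j ι in
/-- **`𝓡(Λ) < 𝓡(Λ′) ⟹ MT(V_{Λ′})(ℂ) ≰ MT(V_Λ)(ℂ)`.** [cite: GreenGriffithsKerr2012, (V.D.5) p. 164 and (V.A.10) p. 158] -/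
theorem not_mumfordTateGroupBaseChange_complex_ofOrientation_le_of_kubotaRank_lt (h : Λ.kubotaRank j ι < Λ'.kubotaRank j ι) :
    ¬ (ofOrientation Λ').mumfordTateGroupBaseChange ℂ ≤ (ofOrientation Λ).mumfordTateGroupBaseChange ℂ :=
  fun hle => absurd h (not_lt.2 (kubotaRank_le_of_mumfordTateGroupBaseChange_complex_ofOrientation_le Λ Λ' j ι hle))

end Transfer

/-! ## §3 The `(ℤ/2)³` example: `MT(V³_{(L,Π)})(ℂ) < MT(V¹_{(L,Θ)})(ℂ) = MT(J_G(V))(ℂ)` -/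

namespace Orientation

namespace CounterexampleVA10

open Literature.NumberTheory.ComplexMultiplication.CounterexampleVA10

variable {L : Type} [Field L] [NumberField L] [IsGalois ℚ L] [IsCMField L] (ι : L →+* ℂ)
  (e : (L ≃ₐ[ℚ] L) ≃* G8) (he : e (conjGal : L ≃ₐ[ℚ] L) = ρ8)

/-- `3` is odd. [folklore] -/
private theorem odd_three_va : Odd (3 : ℤ) := ⟨1, by norm_num⟩

/-- **`W_{p_Π} ≤ W_{p_Θ}` on `Gal(L/ℚ)`** (transport of `W_p ≤ W_t` along `e`). [cite: GreenGriffithsKerr2012, (V.A.10) p. 158 and (V.A.7) p. 157] -/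
theorem degSpan_galoisDeg_orientationPi_le :
    degSpan (L ≃ₐ[ℚ] L) ((orientationPi ι e he).galoisDeg (AlgHom.id ℚ L) ι) ≤
      degSpan (L ≃ₐ[ℚ] L) ((orientationTheta ι e he).galoisDeg (AlgHom.id ℚ L) ι) := by
  rw [orientationPi, orientationTheta, galoisDeg_ofGaloisDeg, galoisDeg_ofGaloisDeg, degSpan_comp_mulEquiv_le_iff]
  exact degSpan_p8_le_degSpan_t8

variable [HodgeTensorFacts.{0, 0}]

/-- **`MT(V³_{(L,Π)})(ℂ) ≤ MT(V¹_{(L,Θ)})(ℂ)`**: the Mumford–Tate group of the degenerate CY-type weight-three SCMpHS `V³_{(L,Π)}` lies in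
that of the weight-one structure of its G-type. [cite: GreenGriffithsKerr2012, (V.D.4) p. 164 and (V.A.10) p. 158] [cite: Deligne1982HodgeCycles, I Example 3.7 (c)] -/
theorem mumfordTateGroupBaseChange_complex_orientationPi_le :
    (ofOrientation (orientationPi ι e he)).mumfordTateGroupBaseChange ℂ ≤
      (ofOrientation (orientationTheta ι e he)).mumfordTateGroupBaseChange ℂ :=
  (mumfordTateGroupBaseChange_complex_ofOrientation_le_iff_degSpan_galoisDeg_le _ _ (AlgHom.id ℚ L) ι).2
    (degSpan_galoisDeg_orientationPi_le ι e he)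

/-- **`MT(V¹_{(L,Θ)})(ℂ) ≰ MT(V³_{(L,Π)})(ℂ)`** (`𝓡(L,Π) = 4 < 5 = 𝓡(L,Θ)`): the Jacobian of the G-type is NOT controlled by `V`.
[cite: GreenGriffithsKerr2012, (V.A.10) p. 158 and (V.D.5) p. 164] -/
theorem not_mumfordTateGroupBaseChange_complex_orientationTheta_le :
    ¬ (ofOrientation (orientationTheta ι e he)).mumfordTateGroupBaseChange ℂ ≤
      (ofOrientation (orientationPi ι e he)).mumfordTateGroupBaseChange ℂ :=
  not_mumfordTateGroupBaseChange_complex_ofOrientation_le_of_kubotaRank_lt _ _ (AlgHom.id ℚ L) ι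
    (kubotaRank_orientationPi_lt ι e he)

/-- **`MT(V³_{(L,Π)})(ℂ) < MT(V¹_{(L,Θ)})(ℂ)`** — STRICT. [cite: GreenGriffithsKerr2012, (V.A.10) p. 158 and (V.D.4)–(V.D.5) p. 164] -/
theorem mumfordTateGroupBaseChange_complex_orientationPi_lt :
    (ofOrientation (orientationPi ι e he)).mumfordTateGroupBaseChange ℂ <
      (ofOrientation (orientationTheta ι e he)).mumfordTateGroupBaseChange ℂ :=
  (mumfordTateGroupBaseChange_complex_orientationPi_le ι e he).lt_of_ne fun h =>
    not_mumfordTateGroupBaseChange_complex_orientationTheta_le ι e he h.ge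

/-- `dim M_φ̃(V³_{(L,Π)}) = 4`. [cite: GreenGriffithsKerr2012, (V.D.5) p. 164 and (V.A.10) p. 158] -/
theorem mtRank_orientationPi : (ofOrientation (orientationPi ι e he)).mtRank = 4 := by
  rw [mtRank_ofOrientation_eq_kubotaRank _ (AlgHom.id ℚ L) ι, kubotaRank_orientationPi]

/-- `dim M_φ̃(V¹_{(L,Θ)}) = 5`. [cite: GreenGriffithsKerr2012, (V.D.5) p. 164 and (V.A.10) p. 158] -/
theorem mtRank_orientationTheta : (ofOrientation (orientationTheta ι e he)).mtRank = 5 := by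
  rw [mtRank_ofOrientation_eq_kubotaRank _ (AlgHom.id ℚ L) ι, kubotaRank_orientationTheta]

omit [HodgeTensorFacts.{0, 0}] in
/-- **`Θ` is the G-type `Θ^G_Π` of g24-#1** (`(endActionOfOrientation Π).gType`): as `1`-orientations, `Θ = Π(Θ^G_Π)`.
[cite: GreenGriffithsKerr2012, (V.A.2) p. 155] -/
theorem orientationTheta_eq_ofCMType_gType :
    orientationTheta ι e he = Orientation.ofCMType ((endActionOfOrientation (orientationPi ι e he)).gType rfl odd_three_va) := by
  ext θ
  rw [orientationTheta_deg]
  by_cases h : 3 < 2 * (orientationPi ι e he).deg θ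
  · rw [if_pos h, ofCMType_deg_of_mem _ ((mem_gType_endActionOfOrientation_iff _ odd_three_va θ).2 h)]
  · rw [if_neg h, ofCMType_deg_of_not_mem _ fun hm => h ((mem_gType_endActionOfOrientation_iff _ odd_three_va θ).1 hm)]

/-- **`MT(V)(ℂ) < MT(J_G(V))(ℂ)` for `V = V³_{(L,Π)}`**: the Mumford–Tate group of a (degenerate, irreducible, CY-type) weight-three SCMpHS
can be a PROPER subgroup of that of its G-Jacobian (Question (V.A.10) at group level). [cite: GreenGriffithsKerr2012, (V.A.10) p. 158 and (V.D.7) p. 165] -/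
theorem mumfordTateGroupBaseChange_complex_orientationPi_lt_gType :
    (ofOrientation (orientationPi ι e he)).mumfordTateGroupBaseChange ℂ <
      (HodgeStructure.ofCMType ((endActionOfOrientation (orientationPi ι e he)).gType rfl odd_three_va)).mumfordTateGroupBaseChange ℂ := by
  rw [← ofOrientation_ofCMType, ← orientationTheta_eq_ofCMType_gType]
  exact mumfordTateGroupBaseChange_complex_orientationPi_lt ι e he

/-- **`MT(J_W(V))(ℂ) ≤ MT(J_G(V))(ℂ)`** for `V = V³_{(L,Π)}`: by g27-#8's surjection `MT(J_W) ≤ MT(V) ⊔ MT(J_G)` and `MT(V) ≤ MT(J_G)`.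
[cite: GreenGriffithsKerr2012, (V.D.7) p. 165 and (V.A.10) p. 158] -/
theorem mumfordTateGroupBaseChange_complex_wType_le_gType :
    (HodgeStructure.ofCMType ((endActionOfOrientation (orientationPi ι e he)).wType rfl odd_three_va)).mumfordTateGroupBaseChange ℂ ≤
      (HodgeStructure.ofCMType ((endActionOfOrientation (orientationPi ι e he)).gType rfl odd_three_va)).mumfordTateGroupBaseChange ℂ :=
  (mumfordTateGroupBaseChange_complex_ofCMType_wType_le_sup (orientationPi ι e he) (orientationPi_effective ι e he)).trans
    (sup_le (mumfordTateGroupBaseChange_complex_orientationPi_lt_gType ι e he).le le_rfl)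

/-- **All three inside `MT(J_G)(ℂ)`: `MT(V)(ℂ) ⊔ MT(J_W)(ℂ) ⊔ MT(J_G)(ℂ) = MT(J_G)(ℂ)`** (`≅ (ℂ^×)^5`) for `V = V³_{(L,Π)}`.
[cite: GreenGriffithsKerr2012, (V.D.7) p. 165 and (V.A.10) p. 158] -/
theorem mumfordTateGroupBaseChange_complex_orientationPi_sup_wType_sup_gType_eq :
    (ofOrientation (orientationPi ι e he)).mumfordTateGroupBaseChange ℂ ⊔
        (HodgeStructure.ofCMType ((endActionOfOrientation (orientationPi ι e he)).wType rfl odd_three_va)).mumfordTateGroupBaseChange ℂ ⊔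
          (HodgeStructure.ofCMType ((endActionOfOrientation (orientationPi ι e he)).gType rfl odd_three_va)).mumfordTateGroupBaseChange ℂ =
      (HodgeStructure.ofCMType ((endActionOfOrientation (orientationPi ι e he)).gType rfl odd_three_va)).mumfordTateGroupBaseChange ℂ :=
  le_antisymm (sup_le (sup_le (mumfordTateGroupBaseChange_complex_orientationPi_lt_gType ι e he).le
    (mumfordTateGroupBaseChange_complex_wType_le_gType ι e he)) le_rfl) le_sup_right

end CounterexampleVA10

end Orientation

end HodgeStructure

end Literature.AlgebraicGeometry.Motives
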